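import Mathlib
import Summits.Ventures.HodgeRepro.Tier4.Target
import Summits.Ventures.HodgeRepro.Tier4.Common.TargetBall
import Summits.Ventures.HodgeRepro.Tier4.Common.AutForms
import Summits.Ventures.HodgeRepro.Tier4.Line3.KMDatum
import Summits.Ventures.HodgeRepro.Tier4.Line3.KernelBounds

/-!
# Tier4/Line3/KernelIntegralPos — L3.7: archimedean positivity of the symmetric quadruple kernel

Blind re-derivation cell `pub-hodge-repro`, Tier 4 «PROVE THE STEP» (README §9–§10), LINE L3 (orbit expansion of the
quadruple theta period; skeleton `Tier4/Line3/Skeleton.lean` v0.7 4b06d5d1… L749–L755 = v0.8 draft L791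
`kernel_integral_pos`, statement unchanged), seat t4-L3-p1 (prover), assigned by the lead (STATUS S12104).
Part 2 of the proof of L3.7; part 1 (sphere lemma, continuity, elementary bounds) is `Tier4/Line3/KernelBounds.lean`.

THE LEMMA (L3.7, step 6 at `∞`): for the symmetric tuple `(a, b, a, b)` the quadruple kernel
`kernel Φ ![a,b,a,b] z = wedge(Φ(y a, z), Φ(y b, z)) · conj(wedge(Φ(y a, z), Φ(y b, z))) = |Φ(y a) ∧ Φ(y b)|²(z) ≥ 0`
is integrable over the ball when the ball coordinates `y a, y b` span a `J`-positive plane, and its integral is positive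
when the wedge is not identically zero.  Stated here over the ball coordinates `ya yb : Fin 3 → ℂ` directly
(`kernel_integral_pos_of_coords`); the skeleton's `T4Data.kernel_integral_pos` is the instance `ya := X.ballCoord a`,
`yb := X.ballCoord b` (the proof term `kernel_integral_pos_of_coords Φ (X.ballCoord a) (X.ballCoord b) hab hpos` closes
it as stated, `kernel` unfolding at `![a, b, a, b]` definitionally — concatenation check on the bus).

PROOF (elementary real analysis on `𝔹 ⊂ ℂ²`; no literature input):
1. The integrand is `((normSq (w z) : ℝ) : ℂ)` with `w z := wedge (datum Φ ya z) (datum Φ yb z)` (`Complex.mul_conj`).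
2. `w` is continuous on the open ball (`KernelBounds.continuousOn_wedge_datum`).
3. BOUNDED NEAR `∂𝔹` (`exists_bound_wedge_annulus`): on the annulus `1 − nsq z ≤ c/2` of the sphere lemma the Gaussian
   `exp(−π(maj ya z + maj yb z)) ≤ e^{−π(quadJ ya + quadJ yb)} · exp(−π c/(1 − nsq z))` beats the polynomial growth
   `(1 − nsq z)^{−2m}` of `KMDatum.growth`.  On the inner compact region `nsq z ≤ 1 − c/2` the wedge is continuous, hence
   bounded (`exists_bound_wedge_ball`).  Bounded and measurable on the finite-measure ball ⇒ `IntegrableOn`.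
4. POSITIVITY: the integrand is `≥ 0`, continuous on the open ball and non-zero at the witness `z₀` of `hab`, hence
   non-zero on a small ball around `z₀` of positive Lebesgue measure (`setIntegral_pos_iff_support_of_nonneg_ae`).

Imports: Mathlib, `Tier4/Target.lean`, Common `TargetBall` / `AutForms`, `Tier4/Line3/KMDatum.lean` and
`Tier4/Line3/KernelBounds.lean`.  `#print axioms kernel_integral_pos_of_coords` = `[propext, Classical.choice,
Quot.sound]`.  Nothing here asserts anything about the truth of (P); HC_CM is NOT proved by anyone in this repository.
-/

set_option autoImplicit false

noncomputable section

namespace Summit.Ventures.HodgeRepro.Tier4.Line3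

open Summit.Ventures.HodgeRepro.Tier4
open Matrix MeasureTheory
open scoped ComplexConjugate

/-! ## 5. The wedge is bounded on the ball -/

section MainBounds

variable (Φ : KMDatum) (ya yb : Fin 3 → ℂ)

/-- `C ≥ 0` in any growth bound (the bound at `z = 0`). -/
theorem growth_const_nonneg {C m : ℝ} (hC : ∀ z ∈ ball, ∀ k i, ‖Φ.ℓ z k i‖ ≤ C / (1 - nsq z) ^ m) :
    0 ≤ C := by
  have h0 : (0 : Fin 2 → ℂ) ∈ ball := by simp [ball, nsq]
  have := hC 0 h0 0 0
  have hn : nsq (0 : Fin 2 → ℂ) = 0 := by simp [nsq]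
  rw [hn, sub_zero, Real.one_rpow, div_one] at this
  exact (norm_nonneg _).trans this

/-- **BOUND ON THE ANNULUS** `1 − nsq z ≤ c/2` (where `φ ≥ c/2`): the Gaussian of the majorant beats the polynomial
growth of the datum. -/
theorem exists_bound_wedge_annulus
    (hpos : ∀ u v : ℂ, (u ≠ 0 ∨ v ≠ 0) → 0 < quadJ (u • ya + v • yb)) :
    ∃ c M : ℝ, 0 < c ∧ ∀ z ∈ ball, 1 - nsq z ≤ c / 2 →
      ‖wedge (datum Φ ya z) (datum Φ yb z)‖ ≤ M := by
  obtain ⟨c, hc, hφ⟩ := exists_pos_le_phi_add ya yb hpos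
  obtain ⟨C, m, hC⟩ := Φ.growth
  have hC0 : 0 ≤ C := growth_const_nonneg Φ hC
  obtain ⟨M₀, hM₀, hbnd⟩ := exists_bound_rpow_exp m (Real.pi * c) (by positivity)
  refine ⟨c, 2 * ((∑ i, ‖ya i‖) * (∑ i, ‖yb i‖)) * (C ^ 2 * M₀) *
    Real.exp (-Real.pi * (quadJ ya + quadJ yb)), hc, ?_⟩
  intro z hz hann
  have hs0 : 0 < 1 - nsq z := sub_pos.mpr hz
  have hs1 : 1 - nsq z ≤ 1 := by
    have : 0 ≤ nsq z := add_nonneg (sq_nonneg _) (sq_nonneg _)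
    linarith
  -- the growth bound at `z`
  have hsm : 0 < (1 - nsq z) ^ m := Real.rpow_pos_of_pos hs0 m
  have hB0 : 0 ≤ C / (1 - nsq z) ^ m := div_nonneg hC0 hsm.le
  have hdot : ∀ (y : Fin 3 → ℂ) (k : Fin 2),
      ‖star y ⬝ᵥ Φ.ℓ z k‖ ≤ (∑ i, ‖y i‖) * (C / (1 - nsq z) ^ m) :=
    fun y k => norm_star_dotProduct_le y _ _ (fun i => hC z hz k i)
  have hd : ∀ (y : Fin 3 → ℂ) (k : Fin 2),
      ‖datum Φ y z k‖ ≤ (∑ i, ‖y i‖) * (C / (1 - nsq z) ^ m) * Real.exp (-Real.pi * maj y z) := by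
    intro y k
    rw [norm_datum]
    exact mul_le_mul_of_nonneg_right (hdot y k) (Real.exp_pos _).le
  -- the wedge is bounded by the product of the four data
  have hw : ‖wedge (datum Φ ya z) (datum Φ yb z)‖ ≤
      2 * ((∑ i, ‖ya i‖) * (∑ i, ‖yb i‖)) * (C / (1 - nsq z) ^ m) ^ 2 *
        (Real.exp (-Real.pi * maj ya z) * Real.exp (-Real.pi * maj yb z)) := by
    unfold wedge
    calc ‖datum Φ ya z 0 * datum Φ yb z 1 - datum Φ ya z 1 * datum Φ yb z 0‖
        ≤ ‖datum Φ ya z 0 * datum Φ yb z 1‖ + ‖datum Φ ya z 1 * datum Φ yb z 0‖ := norm_sub_le _ _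
      _ = ‖datum Φ ya z 0‖ * ‖datum Φ yb z 1‖ + ‖datum Φ ya z 1‖ * ‖datum Φ yb z 0‖ := by
          rw [norm_mul, norm_mul]
      _ ≤ ((∑ i, ‖ya i‖) * (C / (1 - nsq z) ^ m) * Real.exp (-Real.pi * maj ya z)) *
            ((∑ i, ‖yb i‖) * (C / (1 - nsq z) ^ m) * Real.exp (-Real.pi * maj yb z)) +
          ((∑ i, ‖ya i‖) * (C / (1 - nsq z) ^ m) * Real.exp (-Real.pi * maj ya z)) *
            ((∑ i, ‖yb i‖) * (C / (1 - nsq z) ^ m) * Real.exp (-Real.pi * maj yb z)) := by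
          gcongr
          · exact hd ya 0
          · exact hd yb 1
          · exact hd ya 1
          · exact hd yb 0
      _ = 2 * ((∑ i, ‖ya i‖) * (∑ i, ‖yb i‖)) * (C / (1 - nsq z) ^ m) ^ 2 *
            (Real.exp (-Real.pi * maj ya z) * Real.exp (-Real.pi * maj yb z)) := by ring
  -- the Gaussian factor on the annulus
  have hφz : c / 2 ≤ (‖star (lift3 z) ⬝ᵥ (J *ᵥ ya)‖ ^ 2 + ‖star (lift3 z) ⬝ᵥ (J *ᵥ yb)‖ ^ 2) := by
    have := hφ z hz.le
    linarith
  have hexp : Real.exp (-Real.pi * maj ya z) * Real.exp (-Real.pi * maj yb z) ≤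
      Real.exp (-Real.pi * (quadJ ya + quadJ yb)) * Real.exp (-(Real.pi * c / (1 - nsq z))) := by
    rw [← Real.exp_add, ← Real.exp_add, Real.exp_le_exp]
    have key : Real.pi * c / (1 - nsq z) ≤
        Real.pi * (2 * (‖star (lift3 z) ⬝ᵥ (J *ᵥ ya)‖ ^ 2 + ‖star (lift3 z) ⬝ᵥ (J *ᵥ yb)‖ ^ 2) /
          (1 - nsq z)) := by
      rw [mul_div_assoc]
      refine mul_le_mul_of_nonneg_left ?_ Real.pi_pos.le
      rw [div_le_div_iff_of_pos_right hs0]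
      linarith
    have hsum := maj_add_maj ya yb z
    calc -Real.pi * maj ya z + -Real.pi * maj yb z
        = -Real.pi * (maj ya z + maj yb z) := by ring
      _ = -Real.pi * (quadJ ya + quadJ yb +
            2 * (‖star (lift3 z) ⬝ᵥ (J *ᵥ ya)‖ ^ 2 + ‖star (lift3 z) ⬝ᵥ (J *ᵥ yb)‖ ^ 2) /
              (1 - nsq z)) := by rw [hsum]
      _ = -Real.pi * (quadJ ya + quadJ yb) -
            Real.pi * (2 * (‖star (lift3 z) ⬝ᵥ (J *ᵥ ya)‖ ^ 2 + ‖star (lift3 z) ⬝ᵥ (J *ᵥ yb)‖ ^ 2) /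
              (1 - nsq z)) := by ring
      _ ≤ -Real.pi * (quadJ ya + quadJ yb) - Real.pi * c / (1 - nsq z) := sub_le_sub_left key _
      _ = -Real.pi * (quadJ ya + quadJ yb) + -(Real.pi * c / (1 - nsq z)) := by ring
  -- the power times the Gaussian is bounded
  have hBE : (C / (1 - nsq z) ^ m) ^ 2 * Real.exp (-(Real.pi * c / (1 - nsq z))) ≤ C ^ 2 * M₀ := by
    have h := hbnd (1 - nsq z) hs0 hs1
    calc (C / (1 - nsq z) ^ m) ^ 2 * Real.exp (-(Real.pi * c / (1 - nsq z)))
        = C ^ 2 * ((1 / (1 - nsq z) ^ m) ^ 2 * Real.exp (-(Real.pi * c / (1 - nsq z)))) := by ring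
      _ ≤ C ^ 2 * M₀ := by gcongr
  have hSa : 0 ≤ ∑ i, ‖ya i‖ := Finset.sum_nonneg fun i _ => norm_nonneg _
  have hSb : 0 ≤ ∑ i, ‖yb i‖ := Finset.sum_nonneg fun i _ => norm_nonneg _
  calc ‖wedge (datum Φ ya z) (datum Φ yb z)‖
      ≤ 2 * ((∑ i, ‖ya i‖) * (∑ i, ‖yb i‖)) * (C / (1 - nsq z) ^ m) ^ 2 *
          (Real.exp (-Real.pi * maj ya z) * Real.exp (-Real.pi * maj yb z)) := hw
    _ ≤ 2 * ((∑ i, ‖ya i‖) * (∑ i, ‖yb i‖)) * (C / (1 - nsq z) ^ m) ^ 2 *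
          (Real.exp (-Real.pi * (quadJ ya + quadJ yb)) * Real.exp (-(Real.pi * c / (1 - nsq z)))) := by
        gcongr
    _ = 2 * ((∑ i, ‖ya i‖) * (∑ i, ‖yb i‖)) *
          ((C / (1 - nsq z) ^ m) ^ 2 * Real.exp (-(Real.pi * c / (1 - nsq z)))) *
          Real.exp (-Real.pi * (quadJ ya + quadJ yb)) := by ring
    _ ≤ 2 * ((∑ i, ‖ya i‖) * (∑ i, ‖yb i‖)) * (C ^ 2 * M₀) *
          Real.exp (-Real.pi * (quadJ ya + quadJ yb)) := by
        gcongr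

/-- **THE WEDGE IS BOUNDED ON THE BALL**: the annulus bound near `∂𝔹` and continuity on the inner compact region. -/
theorem exists_bound_wedge_ball
    (hpos : ∀ u v : ℂ, (u ≠ 0 ∨ v ≠ 0) → 0 < quadJ (u • ya + v • yb)) :
    ∃ M : ℝ, ∀ z ∈ ball, ‖wedge (datum Φ ya z) (datum Φ yb z)‖ ≤ M := by
  obtain ⟨c, M₁, hc, hM₁⟩ := exists_bound_wedge_annulus Φ ya yb hpos
  have hsub : {z : Fin 2 → ℂ | nsq z ≤ 1 - c / 2} ⊆ ball := fun z hz => by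
    simp only [Set.mem_setOf_eq] at hz
    show nsq z < 1
    linarith
  obtain ⟨M₂, hM₂⟩ := (isCompact_nsq_le (1 - c / 2) (by linarith)).exists_bound_of_continuousOn
    ((continuousOn_wedge_datum Φ ya yb).mono hsub)
  refine ⟨max M₁ M₂, fun z hz => ?_⟩
  by_cases h : nsq z ≤ 1 - c / 2
  · exact (hM₂ z h).trans (le_max_right _ _)
  · exact (hM₁ z hz (by have := not_le.mp h; linarith)).trans (le_max_left _ _)

end MainBounds

/-! ## 6. The ball has finite measure -/

/-- The ball has finite Lebesgue measure (it lies in the closed unit ball of `ℂ²`). -/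
theorem volume_ball_ne_top : (volume : Measure (Fin 2 → ℂ)) ball ≠ ⊤ := by
  have hsub : ball ⊆ {z : Fin 2 → ℂ | nsq z ≤ 1} := fun z hz => by
    show nsq z ≤ 1
    exact le_of_lt hz
  exact ((measure_mono hsub).trans_lt (isCompact_nsq_le 1 le_rfl).measure_lt_top).ne

/-! ## 7. L3.7 -/

/-- **L3.7 ARCHIMEDEAN POSITIVITY, over ball coordinates.**  For `ya, yb ∈ ℂ³` spanning a `J`-positive plane (`hpos`,
the form of the skeleton's hypothesis) the function `|Φ(ya) ∧ Φ(yb)|²(z) = wedge · conj wedge` is integrable over the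
ball, and its integral has positive real part as soon as the wedge is not identically zero (`hab`). -/
theorem kernel_integral_pos_of_coords (Φ : KMDatum) (ya yb : Fin 3 → ℂ)
    (hab : ∃ z ∈ ball, wedge (datum Φ ya z) (datum Φ yb z) ≠ 0)
    (hpos : ∀ u v : ℂ, (u ≠ 0 ∨ v ≠ 0) →
      0 < (star (u • ya + v • yb) ⬝ᵥ (J *ᵥ (u • ya + v • yb))).re) :
    IntegrableOn (fun z => wedge (datum Φ ya z) (datum Φ yb z) *
        conj (wedge (datum Φ ya z) (datum Φ yb z))) ball ∧
      0 < (∫ z in ball, wedge (datum Φ ya z) (datum Φ yb z) *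
        conj (wedge (datum Φ ya z) (datum Φ yb z))).re := by
  have hpos' : ∀ u v : ℂ, (u ≠ 0 ∨ v ≠ 0) → 0 < quadJ (u • ya + v • yb) := fun u v h => by
    rw [← quadJ_eq_re]
    exact hpos u v h
  -- the integrand is the real function `g = normSq ∘ w`, coerced
  have hfg : (fun z => wedge (datum Φ ya z) (datum Φ yb z) * conj (wedge (datum Φ ya z) (datum Φ yb z))) =
      fun z => ((Complex.normSq (wedge (datum Φ ya z) (datum Φ yb z)) : ℝ) : ℂ) := by
    funext z
    rw [Complex.mul_conj]
  rw [hfg]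
  have hwc : ContinuousOn (fun z => wedge (datum Φ ya z) (datum Φ yb z)) ball :=
    continuousOn_wedge_datum Φ ya yb
  have hgc : ContinuousOn (fun z => Complex.normSq (wedge (datum Φ ya z) (datum Φ yb z))) ball :=
    Complex.continuous_normSq.comp_continuousOn hwc
  have hmeas : MeasurableSet ball := isOpen_ball.measurableSet
  obtain ⟨M, hM⟩ := exists_bound_wedge_ball Φ ya yb hpos'
  have hgint : IntegrableOn (fun z => Complex.normSq (wedge (datum Φ ya z) (datum Φ yb z))) ball := by
    refine ⟨hgc.aestronglyMeasurable hmeas, ?_⟩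
    refine HasFiniteIntegral.restrict_of_bounded (M ^ 2) volume_ball_ne_top.lt_top ?_
    refine (ae_restrict_mem hmeas).mono fun z hz => ?_
    rw [Real.norm_eq_abs, abs_of_nonneg (Complex.normSq_nonneg _), Complex.normSq_eq_norm_sq]
    exact pow_le_pow_left₀ (norm_nonneg _) (hM z hz) 2
  refine ⟨hgint.ofReal, ?_⟩
  rw [integral_complex_ofReal, Complex.ofReal_re]
  rw [setIntegral_pos_iff_support_of_nonneg_ae
    (Filter.Eventually.of_forall fun z => Complex.normSq_nonneg _) hgint]
  obtain ⟨z₀, hz₀, hne⟩ := hab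
  have hg0 : Complex.normSq (wedge (datum Φ ya z₀) (datum Φ yb z₀)) ≠ 0 :=
    (Complex.normSq_pos.mpr hne).ne'
  have hcont : ContinuousAt (fun z => Complex.normSq (wedge (datum Φ ya z) (datum Φ yb z))) z₀ :=
    hgc.continuousAt (isOpen_ball.mem_nhds hz₀)
  have hev : ∀ᶠ z in nhds z₀,
      Complex.normSq (wedge (datum Φ ya z) (datum Φ yb z)) ≠ 0 ∧ z ∈ ball :=
    (hcont.eventually_ne hg0).and (isOpen_ball.mem_nhds hz₀)
  obtain ⟨ε, hε, hball⟩ := Metric.eventually_nhds_iff.mp hev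
  have hsub : Metric.ball z₀ ε ⊆
      Function.support (fun z => Complex.normSq (wedge (datum Φ ya z) (datum Φ yb z))) ∩ ball :=
    fun z hz => ⟨(hball (Metric.mem_ball.mp hz)).1, (hball (Metric.mem_ball.mp hz)).2⟩
  exact lt_of_lt_of_le (Metric.measure_ball_pos volume z₀ hε) (measure_mono hsub)

end Summit.Ventures.HodgeRepro.Tier4.Line3

end
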